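import Summits.QuantumFields.YangMills.Theorems.AllWindowsColdBoxBoxHighLineActionSandwichWilson
import Summits.QuantumFields.YangMills.Theorems.AllWindowsColdBoxBoxHighLinePhiTaylor

/-!
# T-S5.6a `actionSandwich : ActionSandwich` BY NAME — the Wilson action plus the gauge-fixing functional is the Hodge form up to a
# RELATIVE error `C·t·H` (STUB-PLAN-S5-STEP2 §5, task file ✓`…Theorems.AllWindowsColdBoxBoxHighLineStep2Defs`; LINE-19 S5 ⟨stmt-QuantumFields-24004⟩/⟨24335⟩)

Width seat `ym-line-sfw-p2-w2` (g31, cell `ym-idea-1`; bricks 1–2 by g30), routed by planner ym-idea-2 g18 («T-S5.6a → w2», 2026-08-29T18:56:41Z /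
19:29:07Z).

**Theorem (`actionSandwich`, `c₀ = 1`, `C = 107874 + 5504·C_Φ` with `C_Φ` the constant of ✓`phiTaylor`).**  For `H ≥ 1`, `0 ≤ t`, `t·H ≤ 1` and every
edge field with all `‖a_e‖ ≤ t`:  `|S(U(a)) + Φ(U(a)) − boxQuadForm H a| ≤ C·t·H·boxQuadForm H a`.

Proof.  ✓T-S5.7e `quadFormSplit`: `boxQuadForm = Σ_{p touching}|ℓ_p|² + Σ_x|(d*a)_x|²`, so the difference splits into the WILSON half
`S(U(a)) − Σ_p|ℓ_p|²` — ✓`WilsonSandwich.abs_boxWilson_sub_sum_linCurvSq_le` (bricks 1–3 + 5: per-plaquette second-order expansion with the cubic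
term carrying the circulation, Cauchy–Schwarz over the plaquettes, ✓S1 Poincaré floor): `≤ (546·tH + 107328·t²H²)·boxQuadForm` — and the GAUGE-FIXING
half `Φ(U(a)) − Σ_x|(d*a)_x|²` — ✓T-S5.7b `phiTaylor` (clause 2, global quartic bound `C_Φ·Σ_x(Σ_e|g_x e|‖a_e‖²)²`) with `Σ_e|g_x e|‖a_e‖² ≤ 8t²`
(eight edges at a site), `Σ_x|g_x e| ≤ 2` (two endpoints) and ✓`BoxQuadForm.sum_norm_sq_le_boxQuadForm`: `≤ 16·344·C_Φ·t²H²·boxQuadForm`;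
finally `t²H² ≤ tH` for `tH ≤ 1`.  The hypothesis `t·H ≤ c₀` is where the bound is RELATIVE (`C·t·H`, not `C·t·H²`).

Everything proved, Mathlib + tree only, standard axioms; no definitions.
HONEST LABEL: T-S5.6a is an M support task of STEP 2 of the XL stub S5 (`stub_landauSecondOrder`) of a critic-PASSed DRAFT line; it is an INPUT of
T-S5.6 / T-S5.13, not a stub of the registered skeleton; S5, U5, ⟨24004⟩ ⟨24335⟩ ⟨24336⟩ remain OPEN; no crux, rung or summit is proved;
**the Yang–Mills mass gap is NOT proved by this file.**
-/

set_option autoImplicit false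

noncomputable section

open Matrix Finset
open Literature.Probability.LatticeModels (Site)
open Literature.MathematicalPhysics.QuantumFieldTheory.AxialGauge (boxEdges)
open Literature.MathematicalPhysics.QuantumLattice (plaquettesTouching)

namespace Summit.QuantumFields.YangMills.Theorems.AllWindowsColdBoxBoxHighLine

namespace ActionSandwichProof

variable {H : ℕ}

/-- At an interior site, `Σ_e |g_x e|·‖a_e‖² ≤ 8t²` when all `‖a_e‖ ≤ t` (eight edges meet `x`). -/
theorem sum_abs_gradVec_norm_sq_le {x : Site 4} (hx : x ∈ interiorSites H) (a : LandauFree H → E3) {t : ℝ}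
    (ha : ∀ e, ‖a e‖ ≤ t) : ∑ e : LandauFree H, |gradVec H x e| * ‖a e‖ ^ 2 ≤ 8 * t ^ 2 := by
  rw [PhiTaylorProof.sum_abs_gradVec_mul hx]
  have h : ∀ e, ‖a e‖ ^ 2 ≤ t ^ 2 := fun e => pow_le_pow_left₀ (norm_nonneg _) (ha e) 2
  calc ∑ μ : Fin 4, ‖a (inEdge hx μ)‖ ^ 2 + ∑ μ : Fin 4, ‖a (outEdge hx μ)‖ ^ 2
      ≤ ∑ _μ : Fin 4, t ^ 2 + ∑ _μ : Fin 4, t ^ 2 :=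
        add_le_add (Finset.sum_le_sum fun μ _ => h _) (Finset.sum_le_sum fun μ _ => h _)
    _ = 8 * t ^ 2 := by simp; ring

/-- An edge lies in the divergence stencil of at most two interior sites: `Σ_{x interior} |g_x e| ≤ 2`. -/
theorem sum_interior_abs_gradVec_le (H : ℕ) (e : LandauFree H) : ∑ x ∈ interiorSites H, |gradVec H x e| ≤ 2 := by
  simp only [PhiTaylorProof.abs_gradVec_eq, Finset.sum_add_distrib, Finset.sum_ite_eq]
  have h1 : (if e.1.1.1 + Pi.single e.1.1.2 1 ∈ interiorSites H then (1 : ℝ) else 0) ≤ 1 := by split_ifs <;> norm_num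
  have h2 : (if e.1.1.1 ∈ interiorSites H then (1 : ℝ) else 0) ≤ 1 := by split_ifs <;> norm_num
  linarith

/-- `Σ_{x interior} Σ_e |g_x e|·‖a_e‖² ≤ 2·Σ_e ‖a_e‖²`. -/
theorem sum_sum_abs_gradVec_norm_sq_le (H : ℕ) (a : LandauFree H → E3) :
    ∑ x ∈ interiorSites H, ∑ e : LandauFree H, |gradVec H x e| * ‖a e‖ ^ 2 ≤ 2 * ∑ e : LandauFree H, ‖a e‖ ^ 2 := by
  rw [Finset.sum_comm, Finset.mul_sum]
  refine Finset.sum_le_sum fun e _ => ?_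
  rw [← Finset.sum_mul]
  exact mul_le_mul_of_nonneg_right (sum_interior_abs_gradVec_le H e) (sq_nonneg _)

/-- The quartic error of ✓`phiTaylor` on fields with `‖a_e‖ ≤ t`: `Σ_x (Σ_e |g_x e|‖a_e‖²)² ≤ 16·t²·Σ_e ‖a_e‖²`. -/
theorem sum_sq_sum_abs_gradVec_le (H : ℕ) (a : LandauFree H → E3) {t : ℝ} (ha : ∀ e, ‖a e‖ ≤ t) :
    ∑ x ∈ interiorSites H, (∑ e : LandauFree H, |gradVec H x e| * ‖a e‖ ^ 2) ^ 2 ≤ 16 * t ^ 2 * ∑ e : LandauFree H, ‖a e‖ ^ 2 := by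
  have hstep : ∀ x ∈ interiorSites H, (∑ e : LandauFree H, |gradVec H x e| * ‖a e‖ ^ 2) ^ 2 ≤
      8 * t ^ 2 * ∑ e : LandauFree H, |gradVec H x e| * ‖a e‖ ^ 2 := by
    intro x hx
    have h0 : 0 ≤ ∑ e : LandauFree H, |gradVec H x e| * ‖a e‖ ^ 2 :=
      Finset.sum_nonneg fun e _ => mul_nonneg (abs_nonneg _) (sq_nonneg _)
    rw [sq]
    exact mul_le_mul_of_nonneg_right (sum_abs_gradVec_norm_sq_le hx a ha) h0
  calc _ ≤ ∑ x ∈ interiorSites H, 8 * t ^ 2 * ∑ e : LandauFree H, |gradVec H x e| * ‖a e‖ ^ 2 := Finset.sum_le_sum hstep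
    _ = 8 * t ^ 2 * ∑ x ∈ interiorSites H, ∑ e : LandauFree H, |gradVec H x e| * ‖a e‖ ^ 2 := by rw [Finset.mul_sum]
    _ ≤ 8 * t ^ 2 * (2 * ∑ e : LandauFree H, ‖a e‖ ^ 2) :=
        mul_le_mul_of_nonneg_left (sum_sum_abs_gradVec_norm_sq_le H a) (by positivity)
    _ = 16 * t ^ 2 * ∑ e : LandauFree H, ‖a e‖ ^ 2 := by ring

/-- **The gauge-fixing half of T-S5.6a** (from ✓`phiTaylor`, clause 2): with the constant `C_Φ` of `PhiTaylor`, for `H ≥ 1` and `‖a_e‖ ≤ t`,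
`|Φ(U(a)) − Σ_x|(d*a)_x|²| ≤ max C_Φ 0 · 5504 · t²·H² · boxQuadForm H a`. -/
theorem abs_landauPhi_sub_divLinSq_le {C : ℝ}
    (hC : ∀ H : ℕ, 1 ≤ H → ∀ a : LandauFree H → E3,
      |landauPhi H (edgeChart H a) - divLinSq H a| ≤
        C * ∑ x ∈ interiorSites H, (∑ e : LandauFree H, |gradVec H x e| * ‖a e‖ ^ 2) ^ 2)
    (hH : 1 ≤ H) (a : LandauFree H → E3) {t : ℝ} (ha : ∀ e, ‖a e‖ ≤ t) :
    |landauPhi H (edgeChart H a) - divLinSq H a| ≤ max C 0 * (5504 * t ^ 2 * (H : ℝ) ^ 2 * boxQuadForm H a) := by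
  have hX0 : 0 ≤ ∑ x ∈ interiorSites H, (∑ e : LandauFree H, |gradVec H x e| * ‖a e‖ ^ 2) ^ 2 :=
    Finset.sum_nonneg fun _ _ => sq_nonneg _
  have hX : ∑ x ∈ interiorSites H, (∑ e : LandauFree H, |gradVec H x e| * ‖a e‖ ^ 2) ^ 2 ≤
      5504 * t ^ 2 * (H : ℝ) ^ 2 * boxQuadForm H a := by
    have h1 := sum_sq_sum_abs_gradVec_le H a ha
    have h2 := BoxQuadForm.sum_norm_sq_le_boxQuadForm hH a
    have h3 : 16 * t ^ 2 * ∑ e : LandauFree H, ‖a e‖ ^ 2 ≤ 16 * t ^ 2 * (344 * (H : ℝ) ^ 2 * boxQuadForm H a) :=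
      mul_le_mul_of_nonneg_left h2 (by positivity)
    linarith
  calc |landauPhi H (edgeChart H a) - divLinSq H a|
      ≤ C * ∑ x ∈ interiorSites H, (∑ e : LandauFree H, |gradVec H x e| * ‖a e‖ ^ 2) ^ 2 := hC H hH a
    _ ≤ max C 0 * ∑ x ∈ interiorSites H, (∑ e : LandauFree H, |gradVec H x e| * ‖a e‖ ^ 2) ^ 2 :=
        mul_le_mul_of_nonneg_right (le_max_left C 0) hX0
    _ ≤ max C 0 * (5504 * t ^ 2 * (H : ℝ) ^ 2 * boxQuadForm H a) := mul_le_mul_of_nonneg_left hX (le_max_right C 0)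

end ActionSandwichProof

open ActionSandwichProof in
/-- **T-S5.6a `ActionSandwich`, BY NAME** (`c₀ = 1`): for `H ≥ 1`, `0 ≤ t`, `t·H ≤ 1` and all `‖a_e‖ ≤ t`,
`|S(U(a)) + Φ(U(a)) − boxQuadForm H a| ≤ C·t·H·boxQuadForm H a` with `C = 107874 + 5504·max C_Φ 0`. -/
theorem actionSandwich : ActionSandwich := by
  obtain ⟨C, hC⟩ := phiTaylor
  refine ⟨107874 + 5504 * max C 0, 1, one_pos, fun H hH t ht0 htH a ha => ?_⟩
  have hH1 : (1 : ℝ) ≤ H := by exact_mod_cast hH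
  have ht1 : t ≤ 1 := by nlinarith
  have hQ0 : 0 ≤ boxQuadForm H a := BoxQuadForm.boxQuadForm_nonneg hH a
  have hW := WilsonSandwich.abs_boxWilson_sub_sum_linCurvSq_le hH ht0 ht1 a ha
  have hΦ := abs_landauPhi_sub_divLinSq_le (fun H hH a => (hC H hH a).2.1) hH a ha
  have hsplit := (quadFormSplit H hH a).1
  have hkey : boxWilson H (edgeChart H a) + landauPhi H (edgeChart H a) - boxQuadForm H a =
      (boxWilson H (edgeChart H a) -
          ∑ p ∈ plaquettesTouching (boxEdges 4 (2 * H + 1)), linCurvSq H (p.1, p.2.1.1, p.2.1.2) a) +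
        (landauPhi H (edgeChart H a) - divLinSq H a) := by
    linarith
  rw [hkey]
  have hmC : 0 ≤ max C 0 := le_max_right C 0
  have htH0 : 0 ≤ t * H := by positivity
  have h1 : t ^ 2 * (H : ℝ) ^ 2 ≤ t * H := by nlinarith
  have e1 : t ^ 2 * (H : ℝ) ^ 2 * boxQuadForm H a ≤ t * H * boxQuadForm H a := mul_le_mul_of_nonneg_right h1 hQ0
  have e2 : max C 0 * (t ^ 2 * (H : ℝ) ^ 2 * boxQuadForm H a) ≤ max C 0 * (t * H * boxQuadForm H a) :=
    mul_le_mul_of_nonneg_left e1 hmC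
  calc |boxWilson H (edgeChart H a) -
            ∑ p ∈ plaquettesTouching (boxEdges 4 (2 * H + 1)), linCurvSq H (p.1, p.2.1.1, p.2.1.2) a +
          (landauPhi H (edgeChart H a) - divLinSq H a)|
      ≤ |boxWilson H (edgeChart H a) -
            ∑ p ∈ plaquettesTouching (boxEdges 4 (2 * H + 1)), linCurvSq H (p.1, p.2.1.1, p.2.1.2) a| +
          |landauPhi H (edgeChart H a) - divLinSq H a| := abs_add_le _ _
    _ ≤ (546 * t * H + 107328 * t ^ 2 * (H : ℝ) ^ 2) * boxQuadForm H a +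
          max C 0 * (5504 * t ^ 2 * (H : ℝ) ^ 2 * boxQuadForm H a) := add_le_add hW hΦ
    _ ≤ (107874 + 5504 * max C 0) * t * H * boxQuadForm H a := by
        have hQtH : 0 ≤ t * H * boxQuadForm H a := mul_nonneg htH0 hQ0
        nlinarith

end Summit.QuantumFields.YangMills.Theorems.AllWindowsColdBoxBoxHighLine

end
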